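import Summits.BirchSwinnertonDyer.Rank1Residual.AdditivePotMult.QuadraticBaseChangeDescentReal
import Summits.BirchSwinnertonDyer.Rank1Residual.AdditivePotMult.ClassTheorems
import HarnessLib

/-!
# X4(M)⁰ / X3♯(M)⁰ class theorems of the base-change-and-descend route WITHOUT the Milne hypothesis,
# for a quadratic field of EITHER signature with odd squarefree discriminant, on S₁
# (row T-MIL-R1, FILE E-4; seat n1011-p01 GEN 7)

HONEST FRAMING (cell `b2b-bsdres`, run/shared/lean/b2b/bsd-rank1-residual/, verbatim in every
file): the goal of the cell is to DELETE the COMBINATION-SHAPED residual classes of the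
Birch–Swinnerton-Dyer formula for ALL analytic-rank `≤ 1` elliptic curves over `ℚ` — "full BSD
formula for every rank `≤ 1` curve in class `C`" assembled STRICTLY from published theorems — so
that the rank-`≤ 1` remainder becomes exactly the CONSTRUCTION-SHAPED classes, which are TYPED
(missing-input `Prop`s), NOT attempted. This is not "finishing BSD". Sub-classes X3♯(M) / X4(M)
(additive, potentially multiplicative prime; base-change-and-descend): a RESEARCH ROUTE; they stay
CONSTRUCTION-SHAPED; nothing is booked by this file; no mark / label moved. THEOREMS ONLY: no
definition, no named fact, no `sorry`.

## What (row T-MIL-R1, FILE E-4; twins of `ClassTheorems.lean`, which is NOT edited)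

`ClassTheorems.bsdp_of_classX4M_of_rankZero_twist` / `bsdp_of_classX3M_of_rankZero_twist` (seat
additive-p1) convert an X4(M) / X3♯(M) pair `(E, p)` of analytic rank `≤ 1` with a
`p`-multiplicative twist `E^{(d_K)}` of analytic rank `0` into the typed over-`K` input
`MissingPPartOverAt W' p` (+ Skinner 2016 Thm. C, resp. + the X2 lower bound) — GIVEN the named
fact A65 `hMilne : Milne1972.bsdQuotient_baseChange_quadratic`. The T-MIL-ODD / T-MIL-SHA /
T-MIL-R1 / T-MIL-REAL ENDs (FILES C-3f, D-2, E-3, F-2) make A65 a THEOREM on the population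
**P₁ := { `K` quadratic (EITHER signature) with `d_K` odd squarefree; `W` on S₁ (good ∨
multiplicative ∨ (`ℓ ∣ d_K` ∧ `Wd` multiplicative) at every place) — e.g. the canonical
`K = ℚ(√p*)`, `p* = (−1)^{(p−1)/2} p`, of ANY X3♯(M)/X4(M) pair, `E` semistable away from `p` }**
in the `ord_p` currency the descent needs. This file records the class theorems ON P₁ WITHOUT
`hMilne`, in both analytic ranks of `E` (through FILE F-2's uniform total-rank-`≤ 1` END
`bsdp_of_pPartOver_of_bsdp_twist_quadratic`):

* `bsdp_of_classX4M_of_rankZero_twist_noMilne` — **X4(M)⁰ ∩ P₁: `BSD(E, p) ⟸ MissingPPartOverAt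
  W' p` ALONE**, the other inputs being `hSk` (Skinner 2016 Thm. C for the twist), `hGZK`, `hmod`;
  `r_an(E) ≤ 1` (E-3's `…_rankLeOne_semistable`: rank `0` via D-2, rank `1` via E-3).
* `bsdp_of_classX3M_of_rankZero_twist_noMilne` — **X3♯(M)⁰ ∩ P₁: `BSD(E, p) ⟸ MissingPPartOverAt
  W' p ∧ MissingLowerBoundAt Wd p`** (+ Wuthrich 2014 Prop. 21 `hW`, `hGZK`, `hmod`).

HONEST LIMITS: P₁ only (`d_K` odd squarefree, S₁); twist of analytic rank `0`;
nothing asserts that such `K` exists for a given pair (Friedberg–Hoffstein; (ram) is a census bit);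
X3♯(M)/X4(M) stay CONSTRUCTION-SHAPED — `MissingPPartOverAt` (and the X2 lower bound) untouched;
TOOL/END theorems; closes no class; moves no mark; `ClassTheorems.lean` untouched.

References: J. S. Milne, Invent. Math. 17 (1972) [Milne1972ArithmeticAV]; C. Skinner, Pacific J.
Math. 283 (2016) Thm. C [Skinner2016PacificMC]; C. Wuthrich, Doc. Math. 19 (2014) Prop. 21
[Wuthrich2014]; R. L. Miller, LMS J. Comput. Math. 14 (2011) Def. 1.1 [Miller2011LMS].
-/

noncomputable section

open scoped Classical NumberField

open WeierstrassCurve NumberField IsDedekindDomain Rat.HeightOneSpectrum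
  Literature.NumberTheory.EllipticCurves Literature.NumberTheory.EllipticCurves.Rank1Residual
  Literature.NumberTheory.EllipticCurves.Rank1Residual.Typed
  Literature.NumberTheory.EllipticCurves.Wuthrich2014

namespace Summit.BirchSwinnertonDyer.Rank1Residual.AdditivePotMult

section NoMilne

variable (W : WeierstrassCurve ℚ) [W.IsElliptic] [W.IsGloballyMinimal] (p : ℕ) [Fact p.Prime]
  (K : Type) [Field K] [NumberField K]
  (Wd : WeierstrassCurve ℚ) [Wd.IsElliptic] [Wd.IsGloballyMinimal]
  (W' : WeierstrassCurve K) [W'.IsElliptic] [W'.IsGloballyMinimal]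

/-- **X4(M)⁰ ∩ P₁ WITHOUT MILNE.** For `(E,p) ∈ X4(M)` (odd additive `p`, `E[p]` irreducible,
`ord_p j < 0`) of analytic rank `≤ 1`, a quadratic field `K` (either signature) with `d_K` odd
squarefree whose twist `Wd = C_d • W^{(d_K)}` is MULTIPLICATIVE at `p`, of analytic rank `0`, with (ram),
`W` on S₁ (good ∨ multiplicative ∨ (`ℓ ∣ d_K` ∧ `Wd` multiplicative) at every place), and a globally
minimal `K`-model `W' = C' • W_K`: **`BSD(E, p)` follows from the typed over-`K` input
`MissingPPartOverAt W' p` ALONE**, the other inputs being the published theorems `hSk` (Skinner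
2016 Thm. C: the twist is COVERED, `bsdp_twist_of_rankZero_ram`), `hGZK`, `hmod` — and NOT Milne's
fact A65 (replaced by the T-MIL-ODD/SHA/R1/REAL ENDs). Twin of
`ClassTheorems.bsdp_of_classX4M_of_rankZero_twist` on P₁. Nothing asserts that such `K` exists for
a given pair. [cite: Skinner2016PacificMC, Thm. C (§1), footnote 1, §2.5]
[cite: Milne1972ArithmeticAV, §1 Thm. 1 and §2 (through DokchitserDokchitserAnnals2010, §2.1, proof of Thm. 8)] -/
theorem bsdp_of_classX4M_of_rankZero_twist_noMilne
    (hGZK : rank_eq_analyticRank_of_analyticRank_le_one) (hmod : hasEntireLFunction_rat)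
    (hSk : Skinner2016.thmC_padicValRat_bsd_rank_zero)
    (hX : ClassX4M W p) (hr : W.analyticRank ≤ 1) (h2 : Module.finrank ℚ K = 2)
    (hdodd : Odd (NumberField.discr K)) (hdsq : Squarefree (NumberField.discr K))
    {Cd : VariableChange ℚ} (hWd : Cd • W.quadraticTwist (NumberField.discr K : ℚ) = Wd)
    (hmult : Mult Wd p) (hram : Ram Wd p) (hr0 : Wd.analyticRank = 0)
    {C' : VariableChange K} (hW' : C' • W.baseChange K = W')
    (hS : ∀ v : HeightOneSpectrum (𝓞 ℚ), W.HasGoodReductionAt v ∨ W.HasMultiplicativeReductionAt v ∨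
      (((primesEquiv v : ℕ) : ℤ) ∣ NumberField.discr K ∧ Wd.HasMultiplicativeReductionAt v))
    (hK : MissingPPartOverAt W' p) : BSDp W p := by
  have hD : (NumberField.discr K : ℚ) ≠ 0 := by exact_mod_cast NumberField.discr_ne_zero K
  obtain ⟨hp2, -, hirrd⟩ := mult_irr_twist_of_classX4M hX hD ⟨Cd, hWd⟩ hmult
  have hd : BSDp Wd p := bsdp_twist_of_rankZero_ram p Wd hSk hGZK hmod hp2 hmult hirrd hram hr0
  exact bsdp_of_pPartOver_of_bsdp_twist_quadratic W p K Wd W' hGZK hmod h2 hdodd hdsq hWd hW'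
    (by omega) (fun v => (hS v).imp_right (Or.imp_right Or.inl)) hp2 hK hd

/-- **X3♯(M)⁰ ∩ P₁ WITHOUT MILNE: `BSD(E,p) ⇐ MissingPPartOverAt(E_K,p) ∧ MissingLowerBoundAt(E^{(D)},p)`.**
For `(E,p) ∈ X3♯(M)` (odd additive Eisenstein `p`, `ord_p j < 0`) of analytic rank `≤ 1`, a
quadratic field `K` (either signature) with `d_K` odd squarefree whose twist `Wd = C_d • W^{(d_K)}`
is MULTIPLICATIVE at `p` and of analytic rank `0`, `W` on S₁, and `W' = C' • W_K` globally minimal: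
`BSD(E,p)` follows from `MissingPPartOverAt W' p` AND the LOWER half `MissingLowerBoundAt Wd p` of
the X2 input of the twist (an X2 pair, `classX2_twist_of_classX3M`; upper half = Wuthrich 2014
Prop. 21, `hW`), with `hGZK`, `hmod` — and NOT Milne's fact A65. Twin of
`ClassTheorems.bsdp_of_classX3M_of_rankZero_twist` on P₁. [cite: Wuthrich2014, Prop. 21]
[cite: Milne1972ArithmeticAV, §1 Thm. 1 and §2 (through DokchitserDokchitserAnnals2010, §2.1, proof of Thm. 8)] -/
theorem bsdp_of_classX3M_of_rankZero_twist_noMilne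
    (hGZK : rank_eq_analyticRank_of_analyticRank_le_one) (hmod : hasEntireLFunction_rat)
    (hW : sha_dvd_analyticSha)
    (hX : ClassX3M W p) (hr : W.analyticRank ≤ 1) (h2 : Module.finrank ℚ K = 2)
    (hdodd : Odd (NumberField.discr K)) (hdsq : Squarefree (NumberField.discr K))
    {Cd : VariableChange ℚ} (hWd : Cd • W.quadraticTwist (NumberField.discr K : ℚ) = Wd)
    (hmult : Mult Wd p) (hr0 : Wd.analyticRank = 0)
    {C' : VariableChange K} (hW' : C' • W.baseChange K = W')
    (hS : ∀ v : HeightOneSpectrum (𝓞 ℚ), W.HasGoodReductionAt v ∨ W.HasMultiplicativeReductionAt v ∨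
      (((primesEquiv v : ℕ) : ℤ) ∣ NumberField.discr K ∧ Wd.HasMultiplicativeReductionAt v))
    (hK : MissingPPartOverAt W' p) (hlow : MissingLowerBoundAt Wd p) : BSDp W p := by
  have hD : (NumberField.discr K : ℚ) ≠ 0 := by exact_mod_cast NumberField.discr_ne_zero K
  have hX2d : ClassX2 Wd p := classX2_twist_of_classX3M hX hD ⟨Cd, hWd⟩ hmult
  have hd : BSDp Wd p := X2.bsdp_of_missingInputAt hW hGZK hmod Wd p (by rw [hr0]; exact zero_le_one)
    hX2d ⟨fun _ => hlow, fun h1 => absurd (hr0.symm.trans h1) (by decide)⟩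
  exact bsdp_of_pPartOver_of_bsdp_twist_quadratic W p K Wd W' hGZK hmod h2 hdodd hdsq hWd hW'
    (by omega) (fun v => (hS v).imp_right (Or.imp_right Or.inl)) hX.p_ne_two hK hd

end NoMilne

end Summit.BirchSwinnertonDyer.Rank1Residual.AdditivePotMult

end
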